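import Literature.NumberTheory.ComplexMultiplication.EllipticUnits.RingOfIntegersPeriodLattice
import Literature.NumberTheory.ComplexMultiplication.EllipticUnits.KatoUnitRepIndependence
import HarnessLib

set_option linter.dupNamespace false
set_option autoImplicit false

/-!
# The CLASS LATTICES `Λ_{L 𝔟} = Ω·ι(𝔪 𝔟⁻¹)` of the twisted class-sum identity `hsum` — ONE family `L : Ideal (𝓞 K) → PeriodPair` for all `𝔟 ≠ 0`

Cell `bsd-print-cf2`, width seat `bsd-line-cf2-p1-w3` g31 (the (e)-assembly packager); print leaf 24720 `KatzDistributionsAtTwoPrint`, R3 endpoint /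
`hsupply` / `hseam` (p764079, p764618).  `--supports stmt-BirchSwinnertonDyer-24720` (helper, Theses-free).  THEOREMS ONLY (no `def`, no named fact,
no `sorry`); nothing is closed; no summit statement is proved by this seat; BSD is not proved by any of this.

WHAT.  `hsum` (p763661) and the complex side (-w7 g14 A7/A8 `twist_mul_interpolationValue_zero_eq_eulerFactor_mul_sum`, -w7 g13's one-stop
`DeShalit1987.sum_twist_eisensteinE_eq_removedEulerFactorsAtZero_mul_continuation`) speak of period pairs `L 𝔟` with lattice
`{Ω·ι(x) : x ∈ 𝔪/𝔟}` (`𝔪/𝔟` the fractional ideal quotient) as HYPOTHESES `hL`/`hL𝔞`; the `∃ T L` of `hsum` must EXHIBIT them.  THIS file does: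
**`exists_classLattices`** — for `K` imaginary quadratic, `ι : K → ℂ`, `𝔪 ≠ 0`, `Ω ≠ 0` there is ONE `L : Ideal (𝓞 K) → PeriodPair` with
`z ∈ (L 𝔟).lattice ↔ ∃ x ∈ (𝔪 : FractionalIdeal)/(𝔟 : FractionalIdeal), z = Ω·ι x` for EVERY `𝔟 ≠ 0` (so it serves every `T` and every `𝔠T` at
once).  Construction: `ι(𝔪)` is a period lattice (`exists_periodPair_mem_iff_ideal`), scale by `Ω` (`PeriodPair.mulLeft`), take the colon lattice
`𝔟⁻¹(Ωι𝔪)` (`exists_periodPair_lattice_eq_idealInvLattice`, an `𝒪_K`-lattice), and identify `𝔟⁻¹(Ωι𝔪) = Ω·ι(𝔪/𝔟)`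
(`FractionalIdeal.mem_div_iff_of_ne_zero`).

References: [deShalit1987] II.2.3 (10) (p. 42), II.3.5 (13) (p. 54), II.4.14 (40) (p. 72); [Silverman1994] Ch. II §1.1.
-/

noncomputable section

open scoped NumberField nonZeroDivisors
open NumberField IsDedekindDomain Field
open Literature.NumberTheory.ComplexMultiplication.EllipticUnits
open Literature.NumberTheory.EllipticCurves (IsImaginaryQuadratic)

namespace Summit.BirchSwinnertonDyer.BirchSwinnertonDyer.Theorems.PrintCf2.KatzMeasureJZeroTop

variable {K : Type} [Field K] [NumberField K]

omit [NumberField K] in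
/-- `Ω·ι(𝔪)` is stable under `𝒪_K` (a CM lattice). [cite: deShalit1987, II.2.3 (10) (p. 42)] -/
theorem isCMLattice_of_mem_iff (ι : K →+* ℂ) {𝔪 : Ideal (𝓞 K)} {Ω : ℂ} {P : PeriodPair}
    (hP : ∀ z : ℂ, z ∈ P.lattice ↔ ∃ a ∈ 𝔪, z = Ω * ι (a : K)) : IsCMLattice ι P.lattice := by
  intro a z hz
  obtain ⟨m, hm, rfl⟩ := (hP z).mp hz
  exact (hP _).mpr ⟨a * m, 𝔪.mul_mem_left a hm, by push_cast; rw [map_mul]; ring⟩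

/-- **The colon lattice `𝔟⁻¹(Ω·ι𝔪)` is `Ω·ι(𝔪/𝔟)`** (`𝔟 ≠ 0`; `𝔪/𝔟` the fractional-ideal quotient `{x : x𝔟 ⊆ 𝔪}`).
[cite: deShalit1987, II.2.3 (10) (p. 42)] -/
theorem mem_idealInvLattice_iff_exists_mem_div (ι : K →+* ℂ) {𝔪 𝔟 : Ideal (𝓞 K)} (h𝔟 : 𝔟 ≠ ⊥) {Ω : ℂ} (hΩ : Ω ≠ 0)
    {P : PeriodPair} (hP : ∀ z : ℂ, z ∈ P.lattice ↔ ∃ a ∈ 𝔪, z = Ω * ι (a : K)) (z : ℂ) :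
    z ∈ idealInvLattice ι 𝔟 P.lattice ↔
      ∃ x ∈ ((𝔪 : FractionalIdeal (𝓞 K)⁰ K) / (𝔟 : FractionalIdeal (𝓞 K)⁰ K)), z = Ω * ι x := by
  have h𝔟0 : (𝔟 : FractionalIdeal (𝓞 K)⁰ K) ≠ 0 := FractionalIdeal.coeIdeal_ne_zero.mpr h𝔟
  rw [mem_idealInvLattice_iff]
  constructor
  · intro h
    obtain ⟨b₀, hb₀, hb₀0⟩ := Submodule.exists_mem_ne_zero_of_ne_bot h𝔟
    have hιb₀ : ι (b₀ : K) ≠ 0 := (map_ne_zero ι).mpr (RingOfIntegers.coe_ne_zero_iff.mpr hb₀0)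
    obtain ⟨m₀, hm₀, hm₀z⟩ := (hP _).mp (h b₀ hb₀)
    refine ⟨(m₀ : K) / (b₀ : K), ?_, ?_⟩
    · rw [FractionalIdeal.mem_div_iff_of_ne_zero h𝔟0]
      intro y hy
      obtain ⟨b, hb, rfl⟩ := FractionalIdeal.mem_coeIdeal _ |>.mp hy
      obtain ⟨m, hm, hmz⟩ := (hP _).mp (h b hb)
      -- `ι b · z = Ω ι m` and `z = Ω ι(m₀/b₀)` ⟹ `m₀ b / b₀ = m`
      have hz : z = Ω * ι ((m₀ : K) / (b₀ : K)) := by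
        rw [map_div₀, ← mul_div_assoc, ← hm₀z, mul_comm, mul_div_assoc, div_self hιb₀, mul_one]
      have key : (m₀ : K) / (b₀ : K) * (algebraMap (𝓞 K) K b) = (m : K) := by
        apply ι.injective
        have h1 : Ω * ι ((m₀ : K) / (b₀ : K) * (b : K)) = Ω * ι (m : K) := by
          rw [← hmz, hz, map_mul]; ring
        exact mul_left_cancel₀ hΩ (by simpa using h1)
      rw [key]
      exact FractionalIdeal.mem_coeIdeal_of_mem _ hm
    · rw [map_div₀, ← mul_div_assoc, ← hm₀z, mul_comm, mul_div_assoc, div_self hιb₀, mul_one]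
  · rintro ⟨x, hx, rfl⟩ b hb
    rw [FractionalIdeal.mem_div_iff_of_ne_zero h𝔟0] at hx
    have hxb := hx (algebraMap (𝓞 K) K b) (FractionalIdeal.mem_coeIdeal_of_mem _ hb)
    obtain ⟨m, hm, hmeq⟩ := (FractionalIdeal.mem_coeIdeal _).mp hxb
    refine (hP _).mpr ⟨m, hm, ?_⟩
    rw [show ι (m : K) = ι (x * (algebraMap (𝓞 K) K b)) by rw [← hmeq], map_mul]
    simp only [RingOfIntegers.coe_eq_algebraMap]
    ring

/-- ★ **THE CLASS LATTICES, all at once**: for `K` imaginary quadratic, `ι : K → ℂ`, `𝔪 ≠ 0`, `Ω ≠ 0` there is `L : Ideal (𝓞 K) → PeriodPair` with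
`Λ_{L 𝔟} = Ω·ι(𝔪/𝔟)` for EVERY `𝔟 ≠ 0` — the `hL`/`hL𝔞` hypotheses of the twisted class-sum identity (`hsum`, A7/A8, the one-stop complex side)
for every system of representatives `T` and every twist `𝔠T` simultaneously. [cite: deShalit1987, II.2.3 (10) (p. 42), II.4.14 (40) (p. 72)]
[cite: Silverman1994, Ch. II §1.1] -/
theorem exists_classLattices (hK : IsImaginaryQuadratic K) (ι : K →+* ℂ) {𝔪 : Ideal (𝓞 K)} (h𝔪 : 𝔪 ≠ ⊥)
    {Ω : ℂ} (hΩ : Ω ≠ 0) :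
    ∃ L : Ideal (𝓞 K) → PeriodPair, ∀ 𝔟 : Ideal (𝓞 K), 𝔟 ≠ ⊥ → ∀ z : ℂ,
      z ∈ (L 𝔟).lattice ↔ ∃ x ∈ ((𝔪 : FractionalIdeal (𝓞 K)⁰ K) / (𝔟 : FractionalIdeal (𝓞 K)⁰ K)), z = Ω * ι x := by
  classical
  -- `Ω·ι(𝔪)` as a period pair
  obtain ⟨P₀, hP₀⟩ := exists_periodPair_mem_iff_ideal hK ι h𝔪
  set P₁ : PeriodPair := P₀.mulLeft Ω hΩ with hP₁def
  have hP₁ : ∀ z : ℂ, z ∈ P₁.lattice ↔ ∃ a ∈ 𝔪, z = Ω * ι (a : K) := by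
    intro z
    rw [hP₁def, PeriodPair.mem_mulLeft_lattice, hP₀]
    constructor
    · rintro ⟨a, ha, h⟩
      exact ⟨a, ha, by rw [← h, ← mul_assoc, mul_inv_cancel₀ hΩ, one_mul]⟩
    · rintro ⟨a, ha, rfl⟩
      exact ⟨a, ha, by rw [← mul_assoc, inv_mul_cancel₀ hΩ, one_mul]⟩
  have hCM : IsCMLattice ι P₁.lattice := isCMLattice_of_mem_iff ι hP₁
  -- the colon lattices, chosen for every `𝔟 ≠ 0`
  have hex : ∀ 𝔟 : Ideal (𝓞 K), 𝔟 ≠ ⊥ → ∃ P : PeriodPair, P.lattice = idealInvLattice ι 𝔟 P₁.lattice :=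
    fun 𝔟 h𝔟 ↦ exists_periodPair_lattice_eq_idealInvLattice hCM h𝔟
  refine ⟨fun 𝔟 ↦ if h : 𝔟 ≠ ⊥ then (hex 𝔟 h).choose else P₁, fun 𝔟 h𝔟 z ↦ ?_⟩
  have hL : (if h : 𝔟 ≠ ⊥ then (hex 𝔟 h).choose else P₁) = (hex 𝔟 h𝔟).choose := dif_pos h𝔟
  change z ∈ (if h : 𝔟 ≠ ⊥ then (hex 𝔟 h).choose else P₁).lattice ↔ _
  rw [hL, (hex 𝔟 h𝔟).choose_spec]
  exact mem_idealInvLattice_iff_exists_mem_div ι h𝔟 hΩ hP₁ z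

end Summit.BirchSwinnertonDyer.BirchSwinnertonDyer.Theorems.PrintCf2.KatzMeasureJZeroTop

end
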